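import Summits.NavierStokesRegularity.FunctionalMining.NoGo.TopEigHeatInverseGap
import HarnessLib

/-!
# FunctionalMining / NoGo — K71: NO EVERYWHERE-SIMPLE EXACT WITNESS — an exact (F2) witness has a
# CROSSING POINT `λ₂ = λ₁`, for EVERY real `q ≥ 1`

HONEST FRAMING. Search for candidate a priori estimates; no regularity claim. Nothing about
Navier–Stokes is proved or asserted in this file. Cell `pub-nsfunc`, no-go seat (gen 55). Door (e) box
of `NOGO.md` (STRUCTURE ONLY) for the open node Lemma L-λ(q) = `TopEigHeatCoercivePos q` (door
(b)/(F2) wants `¬ TopEigHeatCoercivePos q`; `Φ_q = torusTopEigMoment q = ∫ (λ₁⁺)^q`, `λ₁ ≥ λ₂ ≥ λ₃` the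
strain eigenvalues of `v` on `T³`).
CONTEXT. K48 (`NoGo/TopEigHeatExactWitness`) proved that an EXACT witness — `v` smooth, divergence
free, `heatDissipation Φ_q v ≤ 0` — has a TWIN POINT `λ₂(x) = λ₁(x)` at `q = 2`
(`exists_twin_of_exact_two`, via the tree's gap-class coercivity at `q = 2`), and at other `q` only
CONDITIONALLY on gap positivity (`exists_twin_of_nonpos_of_gapPos`). K65 (`NoGo/TopEigHeatInverseGap`,
landed) proved the inverse-gap rule (R14) on EVERYWHERE-SIMPLE fields for every real `q ≥ 1`:
`Φ₁(v)² ≤ 3‖v‖_∞² · heatDissipation Φ_q v · ∫ dx/(qλ₁^{q−1}(λ₁ − λ₂))` (`topEigMoment_one_sq_le`).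
CONTENT (this file = the two put together, every real `q ≥ 1`, no gap-positivity input).
§ 1 `topEigMoment_one_pos_of_simple`: an everywhere-simple divergence-free field has `Φ₁(v) = ∫λ₁ > 0`
(`λ₁ > 0` at simple points of divergence-free fields, tree `lam_pos_of_gapForm_of_isDivFree`);
`integral_inv_strainGapWeight_pos`: `∫ w_q⁻¹ > 0`. § 2 **`heatDissipation_topEigMoment_pos_of_simple`**:
`λ₂ < λ₁` at every point ⇒ `0 < heatDissipation Φ_q v` for every real `q ≥ 1`; quantitative form
**`sq_topEigMoment_one_div_le_heatDissipation`**: `Φ₁(v)²/(3M²∫w_q⁻¹) ≤ heatDissipation Φ_q v`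
(`‖v‖ ≤ M`, `0 < M`) — (R14) read as a FLOOR. § 3 **`exists_twin_of_heat_nonpos`**: for every real
`q ≥ 1`, a smooth divergence-free `v` on `T³` with `heatDissipation Φ_q v ≤ 0` has a point with
`λ₂(x) = λ₁(x)` (no `Φ_q > 0` and no zero-mean hypothesis; zeros of the strain qualify) — the
`∀ q ≥ 1` extension of K48's `exists_twin_of_exact_two`; `not_simple_everywhere_of_heat_nonpos`.
MEANING FOR (F2) (design rule (R18), records only). **(R18) NO EXACT WITNESS IS EVERYWHERE SIMPLE, at
any real `q ≥ 1`: the crossing set `{λ₂ = λ₁}` of an exact witness is NON-EMPTY.** With K70 (R17)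
(staged): off that closed set the top projector is locally constant — an exact witness is a field of
FROZEN top frames glued along a non-empty crossing set. With K69: the everywhere-simple class is
non-empty and calibrated (rate `4π²q` attained) but contains no exact witness; by (R14) a killing family
INSIDE the class must blow up `‖v‖_∞²Φ_q∫w_q⁻¹/Φ₁²`.
NOT CLAIMED: existence or non-existence of an exact witness; any bound on the size of the crossing set;
any verdict on L-λ(q): OPEN in the kernel for every real `q > 1`; (F2) WANTED/OPEN; no node decided.
[ours = §§ 1–3 as stated; via the tree: K65 (R14), `lam_pos_of_gapForm_of_isDivFree`,
`exists_gapForm_of_midEig_lt_topEig`, continuity of `λ₁`, `λ₂` (`StrainEigContinuous`)]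
FILING (prove seat g31, REQUEST #100): declarations byte-identical to the no-go seat's staged `TopEigHeatExactCrossing.STAGING.lean` caea1d2640b05471; this line is the only addition.
-/

noncomputable section

open MeasureTheory Set Filter Topology

namespace Summit.NavierStokesRegularity.FunctionalMining

open Literature.Analysis Literature.Analysis.FunctionSpaces Literature.Analysis.FunctionSpaces.Torus

namespace TopEig.InverseGap

variable {v : UnitAddTorus (Fin 3) → EuclideanSpace ℝ (Fin 3)} {q : ℝ}

/-! ## § 0 Bookkeeping -/

/-- `λ₂ ≤ λ₁` on `T³` (the landed `NoGo/TopEigGapFloor.torusStrainMidEig_le_topEig`, re-derived from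
`torusStrainMidEig_eq_eig_one` because that module is outside this file's import closure; same route
as K48). [folklore] -/
private theorem midEig_le_topEig_fin3 (v : UnitAddTorus (Fin 3) → EuclideanSpace ℝ (Fin 3))
    (x : UnitAddTorus (Fin 3)) : torusStrainMidEig v x ≤ torusStrainTopEig v x := by
  obtain ⟨htop, hmid⟩ := torusStrainMidEig_eq_eig_one v x
  rw [htop, hmid]
  exact torusStrainEig_antitone v x (Fin.le_iff_val_le_val.2 (by simp))

/-- `λ₁ > 0` at every point of an everywhere-simple divergence-free field (tree
`lam_pos_of_gapForm_of_isDivFree`; K65 keeps this private). [tree] -/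
private theorem topEig_pos_of_simple_everywhere (hv : Torus.IsSmooth v) (hdiv : Torus.IsDivFree v)
    (hsimple : ∀ x : UnitAddTorus (Fin 3), torusStrainMidEig v x < torusStrainTopEig v x)
    (x : UnitAddTorus (Fin 3)) : 0 < torusStrainTopEig v x := by
  obtain ⟨e, he1, hSe, hg, hgap⟩ := exists_gapForm_of_midEig_lt_topEig (hsimple x)
  exact (lam_pos_of_gapForm_of_isDivFree hv hdiv he1 hSe hg hgap).2

/-- A smooth field on `T³` is bounded: `∃ M > 0, ‖v‖ ≤ M`. [folklore, bookkeeping] -/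
theorem exists_pos_bound_norm (hv : Torus.IsSmooth v) : ∃ M : ℝ, 0 < M ∧ ∀ x, ‖v x‖ ≤ M := by
  obtain ⟨x₀, -, hx₀⟩ := isCompact_univ.exists_isMaxOn univ_nonempty hv.continuous.norm.continuousOn
  exact ⟨‖v x₀‖ + 1, by positivity, fun x => (hx₀ (mem_univ x)).trans (lt_add_one _).le⟩

/-! ## § 1 `Φ₁ > 0` and `∫ w_q⁻¹ > 0` on everywhere-simple divergence-free fields -/

/-- **`Φ₁(v) = ∫ λ₁ > 0`** for an everywhere-simple smooth divergence-free `v` on `T³`. [ours] -/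
theorem topEigMoment_one_pos_of_simple (hv : Torus.IsSmooth v) (hdiv : Torus.IsDivFree v)
    (hsimple : ∀ x : UnitAddTorus (Fin 3), torusStrainMidEig v x < torusStrainTopEig v x) :
    0 < torusTopEigMoment 1 v := by
  rw [FrameSpread.topEigMoment_one_eq_integral hv hdiv]
  have hpos := topEig_pos_of_simple_everywhere hv hdiv hsimple
  refine (integral_pos_iff_support_of_nonneg (fun x => (hpos x).le)
    (continuous_torusStrainTopEig hv).integrable_unitAddTorus).2 ?_
  rw [show Function.support (torusStrainTopEig v) = univ from
    eq_univ_of_forall fun x => (hpos x).ne', measure_univ]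
  exact one_pos

/-- **`∫ dx/(qλ₁^{q−1}(λ₁ − λ₂)) > 0`** (`q ≥ 1`, everywhere simple, divergence free). [ours, bookkeeping] -/
theorem integral_inv_strainGapWeight_pos (hq : 1 ≤ q) (hv : Torus.IsSmooth v)
    (hdiv : Torus.IsDivFree v)
    (hsimple : ∀ x : UnitAddTorus (Fin 3), torusStrainMidEig v x < torusStrainTopEig v x) :
    0 < ∫ x, (q * torusStrainTopEig v x ^ (q - 1) *
      (torusStrainTopEig v x - torusStrainMidEig v x))⁻¹ := by
  have hpos : ∀ x, 0 < (q * torusStrainTopEig v x ^ (q - 1) *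
      (torusStrainTopEig v x - torusStrainMidEig v x))⁻¹ :=
    fun x => inv_pos.2 (strainGapWeight_pos (by linarith) hv hdiv hsimple x)
  refine (integral_pos_iff_support_of_nonneg (fun x => (hpos x).le)
    (continuous_inv_strainGapWeight hq hv hdiv hsimple).integrable_unitAddTorus).2 ?_
  rw [show (Function.support fun x => (q * torusStrainTopEig v x ^ (q - 1) *
      (torusStrainTopEig v x - torusStrainMidEig v x))⁻¹) = univ from
    eq_univ_of_forall fun x => (hpos x).ne', measure_univ]
  exact one_pos

/-! ## § 2 Everywhere simple ⇒ `heatDissipation Φ_q v > 0`, every real `q ≥ 1` -/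

/-- **NO EVERYWHERE-SIMPLE EXACT WITNESS.** For every real `q ≥ 1` and every smooth divergence-free `v`
on `T³` with `λ₂(x) < λ₁(x)` at EVERY point: `0 < heatDissipation Φ_q v`. Proof: K65's (R14)
`Φ₁² ≤ 3M²·heat·∫w_q⁻¹` with `Φ₁ > 0` (§ 1) and `∫w_q⁻¹ ≥ 0`. [ours] -/
theorem heatDissipation_topEigMoment_pos_of_simple (hq : 1 ≤ q) (hv : Torus.IsSmooth v)
    (hdiv : Torus.IsDivFree v)
    (hsimple : ∀ x : UnitAddTorus (Fin 3), torusStrainMidEig v x < torusStrainTopEig v x) :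
    0 < heatDissipation (torusTopEigMoment q) v := by
  obtain ⟨M, -, hM⟩ := exists_pos_bound_norm hv
  have h := topEigMoment_one_sq_le hq hv hdiv hsimple hM
  have hΦ := topEigMoment_one_pos_of_simple hv hdiv hsimple
  have hB := (integral_inv_strainGapWeight_pos hq hv hdiv hsimple).le
  refine lt_of_not_ge fun hle => ?_
  have h1 : 3 * M ^ 2 * heatDissipation (torusTopEigMoment q) v ≤ 0 :=
    mul_nonpos_iff.2 (Or.inl ⟨by positivity, hle⟩)
  have h2 : 3 * M ^ 2 * heatDissipation (torusTopEigMoment q) v *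
      ∫ x, (q * torusStrainTopEig v x ^ (q - 1) *
        (torusStrainTopEig v x - torusStrainMidEig v x))⁻¹ ≤ 0 :=
    mul_nonpos_iff.2 (Or.inr ⟨h1, hB⟩)
  nlinarith

/-- **(R14) AS A FLOOR.** `Φ₁(v)² / (3M² ∫w_q⁻¹) ≤ heatDissipation Φ_q v` for an everywhere-simple smooth
divergence-free `v` with `‖v‖ ≤ M`, `0 < M`, every real `q ≥ 1`. [ours] -/
theorem sq_topEigMoment_one_div_le_heatDissipation (hq : 1 ≤ q) (hv : Torus.IsSmooth v)
    (hdiv : Torus.IsDivFree v)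
    (hsimple : ∀ x : UnitAddTorus (Fin 3), torusStrainMidEig v x < torusStrainTopEig v x) {M : ℝ}
    (hM0 : 0 < M) (hM : ∀ x, ‖v x‖ ≤ M) :
    torusTopEigMoment 1 v ^ 2 / (3 * M ^ 2 * ∫ x, (q * torusStrainTopEig v x ^ (q - 1) *
      (torusStrainTopEig v x - torusStrainMidEig v x))⁻¹) ≤
      heatDissipation (torusTopEigMoment q) v := by
  have hB := integral_inv_strainGapWeight_pos hq hv hdiv hsimple
  rw [div_le_iff₀ (by positivity)]
  have h := topEigMoment_one_sq_le hq hv hdiv hsimple hM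
  linarith [h]

/-! ## § 3 (R18) An exact witness has a crossing point, every real `q ≥ 1` -/

/-- **An exact witness is NOT everywhere simple** (every real `q ≥ 1`). [ours] -/
theorem not_simple_everywhere_of_heat_nonpos (hq : 1 ≤ q) (hv : Torus.IsSmooth v)
    (hdiv : Torus.IsDivFree v) (h0 : heatDissipation (torusTopEigMoment q) v ≤ 0) :
    ¬ ∀ x : UnitAddTorus (Fin 3), torusStrainMidEig v x < torusStrainTopEig v x :=
  fun hsimple => not_le_of_gt (heatDissipation_topEigMoment_pos_of_simple hq hv hdiv hsimple) h0

/-- **(R18) AN EXACT (F2) WITNESS HAS A TWIN POINT `λ₂(x) = λ₁(x)`, FOR EVERY REAL `q ≥ 1`:** `v` smooth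
and divergence free on `T³` with `heatDissipation Φ_q v ≤ 0` ⇒ `∃ x, λ₂(x) = λ₁(x)`. No `Φ_q(v) > 0`
and no zero-mean hypothesis (zeros of the strain qualify as twin points). The `∀ q ≥ 1` extension of
K48's `exists_twin_of_exact_two`; K48's conditional `exists_twin_of_nonpos_of_gapPos` becomes
unconditional. Nothing about L-λ(q) itself is claimed. [ours] -/
theorem exists_twin_of_heat_nonpos (hq : 1 ≤ q) (hv : Torus.IsSmooth v) (hdiv : Torus.IsDivFree v)
    (h0 : heatDissipation (torusTopEigMoment q) v ≤ 0) :
    ∃ x : UnitAddTorus (Fin 3), torusStrainMidEig v x = torusStrainTopEig v x := by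
  by_contra h
  exact not_simple_everywhere_of_heat_nonpos hq hv hdiv h0
    fun x => lt_of_le_of_ne (midEig_le_topEig_fin3 v x) fun hx => h ⟨x, hx⟩

/-- **(R18), coercivity reading.** On the everywhere-simple class the heat dissipation of `Φ_q` never
vanishes (`q ≥ 1`): a field with `heatDissipation Φ_q v = 0` has a crossing. [ours, corollary] -/
theorem exists_twin_of_heat_eq_zero (hq : 1 ≤ q) (hv : Torus.IsSmooth v) (hdiv : Torus.IsDivFree v)
    (h0 : heatDissipation (torusTopEigMoment q) v = 0) :
    ∃ x : UnitAddTorus (Fin 3), torusStrainMidEig v x = torusStrainTopEig v x :=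
  exists_twin_of_heat_nonpos hq hv hdiv h0.le

end TopEig.InverseGap

end Summit.NavierStokesRegularity.FunctionalMining

end
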